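/-
Copyright (c) 2026. All rights reserved.
Released under Apache 2.0 license as described in the file LICENSE.
-/
import Literature.NumberTheory.LFunctions.FordZetaZeroRecipSqSum
import Literature.NumberTheory.LFunctions.ZetaZeros

/-!
# Helper lemmas for stub_farField

These are sorry-free lemmas toward the negative ordinate bound for stub_farField.
The chain: |kernel| ≤ 3/2/|Im ρ|² → ‖ρ‖² < 2|Im ρ|² → m/|Im ρ|² ≤ 2m/‖ρ‖²
→ neg_ordinate_contribution ≤ 3/2 × 0.0463 < 0.07.
-/

noncomputable section

open Complex Real
open scoped ComplexConjugate

namespace StubFarFieldHelpers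

open Literature.NumberTheory.LFunctions

/-- For nontrivial zeros: ‖ρ‖² < 2|Im ρ|² (since |Im ρ| > 14 and 0 < Re ρ < 1). -/
theorem norm_sq_lt_two_im_sq (ρ : RHWave0.riemannZetaNontrivialZeros) :
    ‖(ρ : ℂ)‖ ^ 2 < 2 * (ρ : ℂ).im ^ 2 := by
  have h14 := FordL33.fourteen_lt_abs_im ρ
  have him : (14 : ℝ) ^ 2 < (ρ : ℂ).im ^ 2 := by
    have := sq_lt_sq' (by linarith) h14
    simp only [sq_abs] at this
    exact this
  have hre_bd : (ρ : ℂ).re ^ 2 < 1 := by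
    have hre0 := ZetaZeros.riemannZetaNontrivialZeros.re_pos ρ.2
    have hre1 := ZetaZeros.riemannZetaNontrivialZeros.re_lt_one ρ.2
    nlinarith [sq_nonneg (ρ : ℂ).re]
  calc ‖(ρ : ℂ)‖ ^ 2 = (ρ : ℂ).re ^ 2 + (ρ : ℂ).im ^ 2 := by
          rw [← Complex.normSq_eq_norm_sq, Complex.normSq_apply]; ring
    _ < 1 + (ρ : ℂ).im ^ 2 := by linarith
    _ < (ρ : ℂ).im ^ 2 + (ρ : ℂ).im ^ 2 := by nlinarith
    _ = 2 * (ρ : ℂ).im ^ 2 := by ring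

/-- For nontrivial zeros: m/|Im ρ|² ≤ 2 m/‖ρ‖². -/
theorem order_div_im_sq_le_two_div_norm_sq (ρ : RHWave0.riemannZetaNontrivialZeros) :
    (riemannZetaZeroOrder (ρ : ℂ) : ℝ) / (ρ : ℂ).im ^ 2 ≤
    2 * (riemannZetaZeroOrder (ρ : ℂ) : ℝ) / ‖(ρ : ℂ)‖ ^ 2 := by
  have hnorm := norm_sq_lt_two_im_sq ρ
  have hm := ZetaZeroSum.zeroOrder_nonneg ρ
  have him2 : 0 < (ρ : ℂ).im ^ 2 := by
    have h14 := FordL33.fourteen_lt_abs_im ρ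
    have := sq_pos_of_pos (lt_of_le_of_lt (by norm_num : (0 : ℝ) ≤ 14) h14)
    rwa [sq_abs] at this
  have hnorm2 : 0 < ‖(ρ : ℂ)‖ ^ 2 := by
    have h14 := FordL33.fourteen_lt_norm ρ
    exact sq_pos_of_pos (lt_of_le_of_lt (by norm_num : (0 : ℝ) ≤ 14) h14)
  have him2_lower : ‖(ρ : ℂ)‖ ^ 2 / 2 < (ρ : ℂ).im ^ 2 := by linarith
  by_cases hm0 : (riemannZetaZeroOrder (ρ : ℂ) : ℝ) = 0
  · simp only [hm0, zero_div, mul_zero]; rfl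
  · have hm_pos : 0 < (riemannZetaZeroOrder (ρ : ℂ) : ℝ) := lt_of_le_of_ne hm (Ne.symm hm0)
    have h1 : 0 < ‖(ρ : ℂ)‖ ^ 2 / 2 := by linarith
    have hlt : (riemannZetaZeroOrder (ρ : ℂ) : ℝ) / (ρ : ℂ).im ^ 2 <
        2 * (riemannZetaZeroOrder (ρ : ℂ) : ℝ) / ‖(ρ : ℂ)‖ ^ 2 :=
      calc (riemannZetaZeroOrder (ρ : ℂ) : ℝ) / (ρ : ℂ).im ^ 2
          < (riemannZetaZeroOrder (ρ : ℂ) : ℝ) / (‖(ρ : ℂ)‖ ^ 2 / 2) :=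
            div_lt_div_of_pos_left hm_pos h1 him2_lower
        _ = 2 * (riemannZetaZeroOrder (ρ : ℂ) : ℝ) / ‖(ρ : ℂ)‖ ^ 2 := by
          field_simp [hnorm2.ne']
    exact le_of_lt hlt

/-- exp 2 < 10 (standard: e² ≈ 7.389 < 10). -/
theorem exp_two_lt_ten : Real.exp 2 < 10 := by
  have he : Real.exp 1 < 2.7182818286 := Real.exp_one_lt_d9
  have he3 : Real.exp 1 < 3 := by linarith
  calc Real.exp 2 = Real.exp 1 * Real.exp 1 := by rw [← Real.exp_add]; norm_num
    _ < 3 * 3 := mul_lt_mul he3 he3.le (Real.exp_pos 1) (by norm_num)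
    _ = 9 := by norm_num
    _ < 10 := by norm_num

end StubFarFieldHelpers
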